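import Mathlib
import HarnessLib
import Summits.HubbardSuperconductivity.HubbardSuperconductivity.Theorems.KLProgrammeKLRegimeFlowReadTransportU0Booking

/-!
# K3 gen-8-FLOW (stmt-HubbardSuperconductivity-20437 `KLRegimeEngineV17F2`, stub (C) `stub_twoLeg_curvature`): «(C2)-U0-FULL» — EVERY (C2)/(T) entry carries the
# factor `U₀`, the value row included (cell gate-hubbard-kl, seat p2 g23)

Follow-up of «(C2)-U0-BOOKING» (…FlowReadTransportU0Booking, pen (R267)(B) GO) and of located «(C2)-Z-LAW»: the (C2) VALUE (`k = 0`) is `O(|U|³)`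
(`|T(θ)| ≤ 12.2·M₁·η₀`, `η₀ = Gfr₀|U|16⁻ⁿ`, `M₁ ≤ m₁U²`), while the `k = 0` bar's primed slot reads `e′ 0·|U|·|U|`; k3c3-p1's row-zero fit spent the third `|U|`
as `|U| ≤ 1`.  Spending it as `|U| ≤ U₀` instead puts `U₀` on the value row too: `e′ 0 := 16·12.2·Gfr₀·m₁·U₀` — so with `U₀` below the #17 threshold every
(C2) entry of every private fit is `(table)·U₀`, and the residual (Z-a)/(Z-b) fits of «(C2)-Z-LAW» both become product laws `(…)·Z j·U₀ ≪ 1`.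
* §1 **`transport_value_u0`** (the `k = 0` row with `U₀`), **`curveJetBar_zero_le_of_tables`** (pointwise re-booking adapter);
* §2/§3 **`transport_jets_flow_fit_of_spaceMoments_u0f`**, **`transport_last_flow_fit_of_spaceMoments_u0f`** — the `_l2` one-calls with tables
  `eT := k ↦ [k ≠ 0]·T k·U₀` (un-primed), `eT′ := k ↦ [k = 0]·T 0·U₀` (primed), `T` = the L2 table in `m`; binder `U ≤ U₀`.
Compositions/arithmetic only; no definitions; nothing here asserts any stub of 20437, K3, the margin or superconductivity.
References: BGM 2006 §2.4 Lemma 2.1 (2.40) [cite: BenfattoGiulianiMastropietro2006].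
-/

noncomputable section

namespace Summit.HubbardSuperconductivity.HubbardSuperconductivity.Theorems.EngineV8

set_option linter.dupNamespace false -- summit = problem name (single-conjunct summit), D-0017
set_option maxSynthPendingDepth 4 -- nested operator-norm instances (fifth Fréchet derivatives), as in the (C2) door

open Real Finset Literature.MathematicalPhysics.QuantumLattice Literature.Probability.LatticeModels
open Literature.MathematicalPhysics.QuantumLattice.FermiRG
open Summit.HubbardSuperconductivity.HubbardSuperconductivity.Theorems.KLRegimeSplit
open Summit.HubbardSuperconductivity.HubbardSuperconductivity.Theorems.DispersionFlow
open Summit.HubbardSuperconductivity.HubbardSuperconductivity.Theorems.PerturbedFermiCurve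

variable {L M : ℕ} [NeZero L] [NeZero M]

/-! ## §1 The value row with `U₀`, and a pointwise re-booking adapter -/

omit [NeZero L] [NeZero M] in
/-- **The (C2) value row with `U₀`**: from the door's `k = 0` row `D₀ ≤ 12.2·M₁·(Gfr₀|U|(4^{2n})⁻¹)` and the law `M₁ ≤ m₁U²`, for `0 < U ≤ U₀`:
`D₀ ≤ curveJetBar e e′ U 0 (n+1)` whenever `e 0 = 0` and `e′ 0 = 16·(12.2·Gfr₀·m₁)·U₀`. -/
theorem transport_value_u0 {R : RenConsts} (hR0 : 0 ≤ R.Gfr 0) {U U₀ : ℝ} (hU : 0 < U) (hU0 : U ≤ U₀) (n : ℕ) {M₁ : ℝ} {m : ℕ → ℝ}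
    (hm1 : 0 ≤ m 1) (hlaw1 : M₁ ≤ m 1 * U ^ 2 * ((4 : ℝ) ^ n) ^ 0) {D₀ : ℝ}
    (hD0 : D₀ ≤ 12.2 * M₁ * (R.Gfr 0 * |U| * ((4 : ℝ) ^ (2 * n))⁻¹)) {e e' : ℕ → ℝ} (he : e 0 = 0)
    (he' : e' 0 = 16 * (12.2 * R.Gfr 0 * m 1) * U₀) : D₀ ≤ curveJetBar e e' U 0 (n + 1) := by
  have hUa : |U| = U := abs_of_pos hU
  rw [curveJetBar_apply, he, he', zero_add, PerturbedFermiCurve.four_zpow_sub_two_mul 0 (n + 1), pow_zero, one_mul, four_pow_two_mul_succ]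
  simp only [uPow, if_true]
  rw [hUa]
  rw [hUa, pow_mul'] at hD0
  rw [pow_zero, mul_one] at hlaw1
  have hη : 0 ≤ R.Gfr 0 * U * (((4 : ℝ) ^ n) ^ 2)⁻¹ := by positivity
  calc D₀ ≤ 12.2 * M₁ * (R.Gfr 0 * U * (((4 : ℝ) ^ n) ^ 2)⁻¹) := hD0
    _ ≤ 12.2 * (m 1 * U ^ 2) * (R.Gfr 0 * U * (((4 : ℝ) ^ n) ^ 2)⁻¹) := by gcongr
    _ = (16 * (12.2 * R.Gfr 0 * m 1) * U) * U * U * (16 * ((4 : ℝ) ^ n) ^ 2)⁻¹ := by rw [mul_inv]; ring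
    _ ≤ (16 * (12.2 * R.Gfr 0 * m 1) * U₀) * U * U * (16 * ((4 : ℝ) ^ n) ^ 2)⁻¹ := by gcongr

omit [NeZero L] [NeZero M] in
/-- **Pointwise re-booking adapter**: `curveJetBar 0 T U k n ≤ curveJetBar e e′ U k n` whenever `T k·U₀ ≤ e k`, `0 ≤ e′ k`, `0 ≤ T k`, `|U| ≤ U₀`. -/
theorem curveJetBar_zero_le_of_tables {T e e' : ℕ → ℝ} {U U₀ : ℝ} (hU : |U| ≤ U₀) {k : ℕ} (hT : 0 ≤ T k) (hek : T k * U₀ ≤ e k)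
    (he'k : 0 ≤ e' k) (n : ℕ) : curveJetBar (fun _ => 0) T U k n ≤ curveJetBar e e' U k n := by
  rw [curveJetBar_apply, curveJetBar_apply]
  refine mul_le_mul_of_nonneg_right (mul_le_mul_of_nonneg_right ?_ (uPow_nonneg k U)) (zpow_nonneg (by norm_num) _)
  have h1 : T k * |U| ≤ e k := (mul_le_mul_of_nonneg_left hU hT).trans hek
  have h2 : 0 ≤ e' k * |U| := mul_nonneg he'k (abs_nonneg U)
  linarith

section General

variable {G : GeoConsts} {Q : EngConsts} {R : RenConsts} (hR : ∀ j, 0 ≤ R.Gfr j) (hGS : ∀ k, 0 ≤ G.S k) (hQS : ∀ k, 0 ≤ Q.S' k)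
  {c U β μ : ℝ} (hc : 0 < c) (hcle : c ≤ klCurveC3 R) (hU : 0 < U) (hUle : U ≤ klCurveU0 R)
  (hG34U : 2 * (R.Gfr 3 + R.Gfr 4) * U ^ 2 ≤ 1) {U₀ : ℝ} (hU0 : U ≤ U₀)
  (hβmin : klBetaMin ≤ β) (hβc : β ≤ Real.exp (c / U ^ 2)) (hμ : μ ∈ klWindowC) {n : ℕ} (hn : n ≤ nScales β)
  (hK₀ : FrameOK R U n μ (klFlowFrameU L M β U μ n)) (hK : FrameOK R U n μ (klFlowFrameU L M β U μ (n + 1)))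
  {X : ℝ} (hX : ∀ l ≤ 4, ∀ x : ℝ, ‖iteratedFDeriv ℝ l salmhoferCutoff x‖ ≤ X)
  {n' : ℕ} (hP : ∀ m ≤ n', FlowPieceJetsAt L M β U μ R m) (hT : ∀ m ≤ n', TwoLegReadJetsF L M G Q β U μ m) (hnn' : n ≤ n')
  (hLdeg : 4 * klFlowDeg (n + 1) ≤ L)
  {z : ℕ → ℝ} {m : ℕ → ℝ} (hm : ∀ j, 0 ≤ m j)

section AtN

variable (hZ : TwoLegDualSpaceMomentsUpToAt L M (klZspLaw z U n) β U μ n 5)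
  (hm1 : 4 / 3 * R.Gfr 1 + 2 * z 1 ≤ m 1) (hm2 : R.Gfr 2 + 2 * z 2 ≤ m 2) (hm3 : R.Gfr 3 / 3 + 2 * z 3 ≤ m 3)
  (hm4 : R.Gfr 4 / 15 + 2 * z 4 ≤ m 4) (hm5 : 2 ^ 5 * (Real.pi ^ 8 / 4 * 2 ^ 4 * (2 : ℝ) ^ 32) * (curveExtC X G.S 1 + curveExtC X Q.S' 1 * |U|) / 63 + 2 * z 5 ≤ m 5)
include hR hGS hQS hc hcle hU hUle hG34U hU0 hβmin hβc hμ hn hK₀ hK hX hP hT hnn' hLdeg hm hZ hm1 hm2 hm3 hm4 hm5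

/-- **«(C2)-U0-FULL»** — `transport_jets_flow_fit_of_spaceMoments_u0f`: the `_l2` one-call with EVERY (C2) entry carrying `U₀` (`|U| ≤ U₀`): rows `k ≥ 1` un-primed as
`T k·U₀` (`curveJetBar_zero_le_of_tables`), and the value row primed as `T 0·U₀` (`transport_value_u0`: the (C2) value is `O(|U|³)`). -/
theorem transport_jets_flow_fit_of_spaceMoments_u0f :
    ContDiff ℝ 4 (fun θ : ℝ =>
      (symInterp L (klLocSelfEnergyRe L M β U μ (klFlowFrameU L M β U μ n) n)).eval (klFermiPoint μ (klFlowFrameU L M β U μ (n + 1)) θ) -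
        klLocalPart L M β U μ (klFlowFrameU L M β U μ n) n θ) ∧
    ∀ k ≤ 4, ∀ θ : ℝ, |iteratedDeriv k (fun θ : ℝ =>
      (symInterp L (klLocSelfEnergyRe L M β U μ (klFlowFrameU L M β U μ n) n)).eval (klFermiPoint μ (klFlowFrameU L M β U μ (n + 1)) θ) -
        klLocalPart L M β U μ (klFlowFrameU L M β U μ n) n θ) θ| ≤
      curveJetBar (fun k : ℕ => if k = 0 then 0 else
        (fun k : ℕ =>
          if k = 0 then 16 * ((12.2 * R.Gfr 0 * m 1))
          else if k = 1 then 4 * ((1420 * 2 * (R.Gfr 1 + R.Gfr 2 + R.Gfr 3 + R.Gfr 4) * 2 * m 1) + (36400 * R.Gfr 0 * m 1) + (2820 * R.Gfr 0 * m 2))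
          else if k = 2 then ((12900000 * 2 ^ 2 * (R.Gfr 1 + R.Gfr 2 + R.Gfr 3 + R.Gfr 4) * 2 ^ 2 * m 1) + (657000 * 2 * (R.Gfr 1 + R.Gfr 2 + R.Gfr 3 + R.Gfr 4) * 2 * m 2) + (338000000 * 2 * R.Gfr 0 * 2 * m 1) + (25400000 * R.Gfr 0 * m 2) + (652000 * R.Gfr 0 * m 3))
          else if k = 3 then ((199000000000 * 2 ^ 3 * (R.Gfr 1 + R.Gfr 2 + R.Gfr 3 + R.Gfr 4) * 2 ^ 3 * m 1) + (12000000000 * 2 ^ 2 * (R.Gfr 1 + R.Gfr 2 + R.Gfr 3 + R.Gfr 4) * 2 ^ 2 * m 2) + (228000000 * 2 * (R.Gfr 1 + R.Gfr 2 + R.Gfr 3 + R.Gfr 4) * 2 * m 3) + (5230000000000 * 2 ^ 2 * R.Gfr 0 * 2 ^ 2 * m 1) + (392000000000 * 2 * R.Gfr 0 * 2 * m 2) + (11800000000 * R.Gfr 0 * m 3) + (151000000 * R.Gfr 0 * m 4)) / 4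
          else if k = 4 then ((4300000000000000 * 2 ^ 4 * (R.Gfr 1 + R.Gfr 2 + R.Gfr 3 + R.Gfr 4) * 2 ^ 4 * m 1) + (276000000000000 * 2 ^ 3 * (R.Gfr 1 + R.Gfr 2 + R.Gfr 3 + R.Gfr 4) * 2 ^ 3 * m 2) + (6890000000000 * 2 ^ 2 * (R.Gfr 1 + R.Gfr 2 + R.Gfr 3 + R.Gfr 4) * 2 ^ 2 * m 3) + (70100000000 * 2 * (R.Gfr 1 + R.Gfr 2 + R.Gfr 3 + R.Gfr 4) * 2 * m 4) + (114000000000000000 * 2 ^ 2 * R.Gfr 0 * 2 ^ 2 * m 1) + (8490000000000000 * 2 ^ 2 * R.Gfr 0 * 2 ^ 2 * m 2) + (272000000000000 * 2 * R.Gfr 0 * 2 * m 3) + (4530000000000 * R.Gfr 0 * m 4) + (34800000000 * R.Gfr 0 * m 5) + (69200000000 * (16 / 15) * R.Gfr 4 * m 1)) / 16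
          else 0) k * U₀)
        (fun k : ℕ => if k = 0 then
        (fun k : ℕ =>
          if k = 0 then 16 * ((12.2 * R.Gfr 0 * m 1))
          else if k = 1 then 4 * ((1420 * 2 * (R.Gfr 1 + R.Gfr 2 + R.Gfr 3 + R.Gfr 4) * 2 * m 1) + (36400 * R.Gfr 0 * m 1) + (2820 * R.Gfr 0 * m 2))
          else if k = 2 then ((12900000 * 2 ^ 2 * (R.Gfr 1 + R.Gfr 2 + R.Gfr 3 + R.Gfr 4) * 2 ^ 2 * m 1) + (657000 * 2 * (R.Gfr 1 + R.Gfr 2 + R.Gfr 3 + R.Gfr 4) * 2 * m 2) + (338000000 * 2 * R.Gfr 0 * 2 * m 1) + (25400000 * R.Gfr 0 * m 2) + (652000 * R.Gfr 0 * m 3))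
          else if k = 3 then ((199000000000 * 2 ^ 3 * (R.Gfr 1 + R.Gfr 2 + R.Gfr 3 + R.Gfr 4) * 2 ^ 3 * m 1) + (12000000000 * 2 ^ 2 * (R.Gfr 1 + R.Gfr 2 + R.Gfr 3 + R.Gfr 4) * 2 ^ 2 * m 2) + (228000000 * 2 * (R.Gfr 1 + R.Gfr 2 + R.Gfr 3 + R.Gfr 4) * 2 * m 3) + (5230000000000 * 2 ^ 2 * R.Gfr 0 * 2 ^ 2 * m 1) + (392000000000 * 2 * R.Gfr 0 * 2 * m 2) + (11800000000 * R.Gfr 0 * m 3) + (151000000 * R.Gfr 0 * m 4)) / 4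
          else if k = 4 then ((4300000000000000 * 2 ^ 4 * (R.Gfr 1 + R.Gfr 2 + R.Gfr 3 + R.Gfr 4) * 2 ^ 4 * m 1) + (276000000000000 * 2 ^ 3 * (R.Gfr 1 + R.Gfr 2 + R.Gfr 3 + R.Gfr 4) * 2 ^ 3 * m 2) + (6890000000000 * 2 ^ 2 * (R.Gfr 1 + R.Gfr 2 + R.Gfr 3 + R.Gfr 4) * 2 ^ 2 * m 3) + (70100000000 * 2 * (R.Gfr 1 + R.Gfr 2 + R.Gfr 3 + R.Gfr 4) * 2 * m 4) + (114000000000000000 * 2 ^ 2 * R.Gfr 0 * 2 ^ 2 * m 1) + (8490000000000000 * 2 ^ 2 * R.Gfr 0 * 2 ^ 2 * m 2) + (272000000000000 * 2 * R.Gfr 0 * 2 * m 3) + (4530000000000 * R.Gfr 0 * m 4) + (34800000000 * R.Gfr 0 * m 5) + (69200000000 * (16 / 15) * R.Gfr 4 * m 1)) / 16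
          else 0) 0 * U₀ else 0)
        U k (n + 1) := by
  obtain ⟨hdeg, -⟩ := degree_klFlowFrameU_le_half (L := L) (M := M) (β := β) (U := U) (μ := μ) (n := n) hLdeg
  have hβ0 : 0 < β := KLRegimeSplit.pos_of_klBetaMin_le hβmin
  have ha := flowFrame_jets_lawA (L := L) (M := M) hR hGS hQS hμ hX hP hT (n := n) (by omega)
  have hb := sep_jets_of_twoLegDualSpaceMomentsUpToAt hβ0 hZ
  obtain ⟨hM₁, hM₂, hM₃, hM₄, hM₅⟩ := cumulativeSymbol_nested_sizes_of_split (L := L) (M := M) β U μ hdeg n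
    (a := fun j => (if j = 1 then 4 / 3 * R.Gfr 1 * U ^ 2 * ((4 : ℝ) ^ n) ^ 0 else if j = 2 then R.Gfr 2 * U ^ 2 * ((4 : ℝ) ^ n) ^ 1 else if j = 3 then R.Gfr 3 / 3 * U ^ 2 * ((4 : ℝ) ^ n) ^ 2 else if j = 4 then R.Gfr 4 / 15 * U ^ 2 * ((4 : ℝ) ^ n) ^ 3 else 2 ^ 5 * (Real.pi ^ 8 / 4 * 2 ^ 4 * (2 : ℝ) ^ 32) * (curveExtC X G.S 1 + curveExtC X Q.S' 1 * |U|) / 63 * U ^ 2 * ((4 : ℝ) ^ n) ^ 4))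
    (b := fun j => 2 * klZspLaw z U n j) ha hb
  have hF := cumulativeSymbol_contDiff (L := L) (M := M) β U μ (klFlowFrameU L M β U μ n) n (k := 5)
  have hw : ∀ p : ℕ, 0 ≤ U ^ 2 * ((4 : ℝ) ^ n) ^ p := fun p => by positivity
  have hlaw1 : (if (1 : ℕ) = 1 then 4 / 3 * R.Gfr 1 * U ^ 2 * ((4 : ℝ) ^ n) ^ 0 else if (1 : ℕ) = 2 then R.Gfr 2 * U ^ 2 * ((4 : ℝ) ^ n) ^ 1 else if (1 : ℕ) = 3 then R.Gfr 3 / 3 * U ^ 2 * ((4 : ℝ) ^ n) ^ 2 else if (1 : ℕ) = 4 then R.Gfr 4 / 15 * U ^ 2 * ((4 : ℝ) ^ n) ^ 3 else 2 ^ 5 * (Real.pi ^ 8 / 4 * 2 ^ 4 * (2 : ℝ) ^ 32) * (curveExtC X G.S 1 + curveExtC X Q.S' 1 * |U|) / 63 * U ^ 2 * ((4 : ℝ) ^ n) ^ 4) + 2 * klZspLaw z U n 1 ≤ m 1 * U ^ 2 * ((4 : ℝ) ^ n) ^ 0 := by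
    rw [if_pos rfl, two_mul_klZspLaw, show (1 : ℕ) - 1 = 0 from rfl]
    calc _ = (4 / 3 * R.Gfr 1 + 2 * z 1) * (U ^ 2 * ((4 : ℝ) ^ n) ^ 0) := by ring
      _ ≤ m 1 * (U ^ 2 * ((4 : ℝ) ^ n) ^ 0) := mul_le_mul_of_nonneg_right hm1 (hw 0)
      _ = m 1 * U ^ 2 * ((4 : ℝ) ^ n) ^ 0 := by ring
  have hlaw2 : (if (2 : ℕ) = 1 then 4 / 3 * R.Gfr 1 * U ^ 2 * ((4 : ℝ) ^ n) ^ 0 else if (2 : ℕ) = 2 then R.Gfr 2 * U ^ 2 * ((4 : ℝ) ^ n) ^ 1 else if (2 : ℕ) = 3 then R.Gfr 3 / 3 * U ^ 2 * ((4 : ℝ) ^ n) ^ 2 else if (2 : ℕ) = 4 then R.Gfr 4 / 15 * U ^ 2 * ((4 : ℝ) ^ n) ^ 3 else 2 ^ 5 * (Real.pi ^ 8 / 4 * 2 ^ 4 * (2 : ℝ) ^ 32) * (curveExtC X G.S 1 + curveExtC X Q.S' 1 * |U|) / 63 * U ^ 2 * ((4 : ℝ) ^ n) ^ 4) + 2 *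 klZspLaw z U n 2 ≤ m 2 * U ^ 2 * ((4 : ℝ) ^ n) ^ 1 := by
    rw [if_neg (by norm_num), if_pos rfl, two_mul_klZspLaw, show (2 : ℕ) - 1 = 1 from rfl]
    calc _ = (R.Gfr 2 + 2 * z 2) * (U ^ 2 * ((4 : ℝ) ^ n) ^ 1) := by ring
      _ ≤ m 2 * (U ^ 2 * ((4 : ℝ) ^ n) ^ 1) := mul_le_mul_of_nonneg_right hm2 (hw 1)
      _ = m 2 * U ^ 2 * ((4 : ℝ) ^ n) ^ 1 := by ring
  have hlaw3 : (if (3 : ℕ) = 1 then 4 / 3 * R.Gfr 1 * U ^ 2 * ((4 : ℝ) ^ n) ^ 0 else if (3 : ℕ) = 2 then R.Gfr 2 * U ^ 2 * ((4 : ℝ) ^ n) ^ 1 else if (3 : ℕ) = 3 then R.Gfr 3 / 3 * U ^ 2 * ((4 : ℝ) ^ n) ^ 2 else if (3 : ℕ) = 4 then R.Gfr 4 / 15 * U ^ 2 * ((4 : ℝ) ^ n) ^ 3 else 2 ^ 5 * (Real.pi ^ 8 / 4 * 2 ^ 4 * (2 : ℝ) ^ 32) * (curveExtC X G.S 1 +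 curveExtC X Q.S' 1 * |U|) / 63 * U ^ 2 * ((4 : ℝ) ^ n) ^ 4) + 2 * klZspLaw z U n 3 ≤ m 3 * U ^ 2 * ((4 : ℝ) ^ n) ^ 2 := by
    rw [if_neg (by norm_num), if_neg (by norm_num), if_pos rfl, two_mul_klZspLaw, show (3 : ℕ) - 1 = 2 from rfl]
    calc _ = (R.Gfr 3 / 3 + 2 * z 3) * (U ^ 2 * ((4 : ℝ) ^ n) ^ 2) := by ring
      _ ≤ m 3 * (U ^ 2 * ((4 : ℝ) ^ n) ^ 2) := mul_le_mul_of_nonneg_right hm3 (hw 2)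
      _ = m 3 * U ^ 2 * ((4 : ℝ) ^ n) ^ 2 := by ring
  have hlaw4 : (if (4 : ℕ) = 1 then 4 / 3 * R.Gfr 1 * U ^ 2 * ((4 : ℝ) ^ n) ^ 0 else if (4 : ℕ) = 2 then R.Gfr 2 * U ^ 2 * ((4 : ℝ) ^ n) ^ 1 else if (4 : ℕ) = 3 then R.Gfr 3 / 3 * U ^ 2 * ((4 : ℝ) ^ n) ^ 2 else if (4 : ℕ) = 4 then R.Gfr 4 / 15 * U ^ 2 * ((4 : ℝ) ^ n) ^ 3 else 2 ^ 5 * (Real.pi ^ 8 / 4 * 2 ^ 4 * (2 : ℝ) ^ 32) * (curveExtC X G.S 1 + curveExtC X Q.S' 1 * |U|) / 63 * U ^ 2 * ((4 : ℝ) ^ n) ^ 4) + 2 * klZspLaw z U n 4 ≤ m 4 * U ^ 2 * ((4 : ℝ) ^ n) ^ 3 := by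
    rw [if_neg (by norm_num), if_neg (by norm_num), if_neg (by norm_num), if_pos rfl, two_mul_klZspLaw, show (4 : ℕ) - 1 = 3 from rfl]
    calc _ = (R.Gfr 4 / 15 + 2 * z 4) * (U ^ 2 * ((4 : ℝ) ^ n) ^ 3) := by ring
      _ ≤ m 4 * (U ^ 2 * ((4 : ℝ) ^ n) ^ 3) := mul_le_mul_of_nonneg_right hm4 (hw 3)
      _ = m 4 * U ^ 2 * ((4 : ℝ) ^ n) ^ 3 := by ring
  have hlaw5 : (if (5 : ℕ) = 1 then 4 / 3 * R.Gfr 1 * U ^ 2 * ((4 : ℝ) ^ n) ^ 0 else if (5 : ℕ) = 2 then R.Gfr 2 * U ^ 2 * ((4 : ℝ) ^ n) ^ 1 else if (5 : ℕ) = 3 then R.Gfr 3 / 3 * U ^ 2 * ((4 : ℝ) ^ n) ^ 2 else if (5 : ℕ) = 4 then R.Gfr 4 / 15 * U ^ 2 * ((4 : ℝ) ^ n) ^ 3 else 2 ^ 5 * (Real.pi ^ 8 / 4 * 2 ^ 4 * (2 : ℝ) ^ 32) * (curveExtC X G.S 1 + curveExtC X Q.S' 1 * |U|) / 63 * U ^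 2 * ((4 : ℝ) ^ n) ^ 4) + 2 * klZspLaw z U n 5 ≤ m 5 * U ^ 2 * ((4 : ℝ) ^ n) ^ 4 := by
    rw [if_neg (by norm_num), if_neg (by norm_num), if_neg (by norm_num), if_neg (by norm_num), two_mul_klZspLaw, show (5 : ℕ) - 1 = 4 from rfl]
    calc _ = (2 ^ 5 * (Real.pi ^ 8 / 4 * 2 ^ 4 * (2 : ℝ) ^ 32) * (curveExtC X G.S 1 + curveExtC X Q.S' 1 * |U|) / 63 + 2 * z 5) * (U ^ 2 * ((4 : ℝ) ^ n) ^ 4) := by ring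
      _ ≤ m 5 * (U ^ 2 * ((4 : ℝ) ^ n) ^ 4) := mul_le_mul_of_nonneg_right hm5 (hw 4)
      _ = m 5 * U ^ 2 * ((4 : ℝ) ^ n) ^ 4 := by ring
  obtain ⟨hl1, hA3, hA4, hh0, hhη⟩ := flow_graded_params hR U n
  have hη_nn : 0 ≤ (R.Gfr 1 + R.Gfr 2 + R.Gfr 3 + R.Gfr 4) * U ^ 2 * ((4 : ℝ) ^ (2 * n))⁻¹ := by
    have := hR 1; have := hR 2; have := hR 3; have := hR 4; positivity
  have hη₀_nn : 0 ≤ R.Gfr 0 * |U| * ((4 : ℝ) ^ (2 * n))⁻¹ := by have := hR 0; positivity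
  obtain ⟨hdiff, hrows⟩ := transport_jets_flow hR hc hcle hU hUle hβmin hβc hμ hn hK₀ hK (hP n hnn') hη_nn hη₀_nn hl1 hA3 hA4 hh0 hhη hF
    hM₁ hM₂ hM₃ hM₄ hM₅
  refine ⟨hdiff, fun k hk θ => ?_⟩
  obtain ⟨r0, r1, r2, r3, r4⟩ := hrows θ
  have hU1 : U ≤ 1 := hUle.trans (klCurveU0_le_one R)
  have hM1' := by have h := hM₁ 0; exact le_trans (by positivity) h
  have hM2' := by have h := hM₂ 0; exact le_trans (by positivity) h
  have hM3' := by have h := hM₃ 0; exact le_trans (by positivity) h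
  have hM4' := by have h := hM₄ 0; exact le_trans (by positivity) h
  have hM5' := by have h := hM₅ 0; exact le_trans (by positivity) h
  have hUabs : |U| ≤ U₀ := by rwa [abs_of_pos hU]
  by_cases hk0 : k = 0
  · subst hk0
    exact transport_value_u0 (hR 0) hU hU0 n (hm 1) hlaw1 r0 (if_pos rfl) (by norm_num)
  · have hrow := transport_rows_fit_l2 hR hU hU1 hG34U n hM1' hM2' hM3' hM4' hM5' hm hlaw1 hlaw2 hlaw3 hlaw4 hlaw5
      (D := (fun k => |iteratedDeriv k (fun θ : ℝ =>
      (symInterp L (klLocSelfEnergyRe L M β U μ (klFlowFrameU L M β U μ n) n)).eval (klFermiPoint μ (klFlowFrameU L M β U μ (n + 1)) θ) -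
        klLocalPart L M β U μ (klFlowFrameU L M β U μ n) n θ) θ|)) r0 r1 r2 r3 r4 k hk
    exact hrow.trans (curveJetBar_zero_le_of_tables hUabs (transportTableL2_nonneg hR hm k) (by simp [hk0]) (by simp [hk0]) (n + 1))


end AtN

section AtSucc

variable (hz : ∀ j, 0 ≤ z j) (hZ' : TwoLegDualSpaceMomentsUpToAt L M (klZspLaw z U (n + 1)) β U μ (n + 1) 5)
  (hl1 : 4 / 3 * R.Gfr 1 + 2 * z 1 ≤ m 1) (hl2 : R.Gfr 2 + 8 * z 2 ≤ m 2) (hl3 : R.Gfr 3 / 3 + 32 * z 3 ≤ m 3)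
  (hl4 : R.Gfr 4 / 15 + 128 * z 4 ≤ m 4) (hl5 : 2 ^ 5 * (Real.pi ^ 8 / 4 * 2 ^ 4 * (2 : ℝ) ^ 32) * (curveExtC X G.S 1 + curveExtC X Q.S' 1 * |U|) / 63 + 512 * z 5 ≤ m 5)
include hR hGS hQS hc hcle hU hUle hG34U hU0 hβmin hβc hμ hn hK₀ hK hX hP hT hnn' hLdeg hz hm hZ' hl1 hl2 hl3 hl4 hl5

/-! ## §3 The last index, full U₀ booking -/

/-- **«(C2)-U0-FULL»** — `transport_last_flow_fit_of_spaceMoments_u0f`: the `_l2` one-call with EVERY (C2) entry carrying `U₀` (`|U| ≤ U₀`): rows `k ≥ 1` un-primed as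
`T k·U₀` (`curveJetBar_zero_le_of_tables`), and the value row primed as `T 0·U₀` (`transport_value_u0`: the (C2) value is `O(|U|³)`). -/
theorem transport_last_flow_fit_of_spaceMoments_u0f :
    ContDiff ℝ 4 (fun θ : ℝ =>
      ((symInterp L (klLocSelfEnergyRe L M β U μ (klFlowFrameU L M β U μ (n + 1)) (n + 1))).eval
            (klFermiPoint μ (klFlowFrameU L M β U μ (n + 1)) θ) +
          (klFlowPiece L M β U μ n).eval (klFermiPoint μ (klFlowFrameU L M β U μ (n + 1)) θ)) -
        ((symInterp L (klLocSelfEnergyRe L M β U μ (klFlowFrameU L M β U μ (n + 1)) (n + 1))).eval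
            (klFermiPoint μ (klFlowFrameU L M β U μ n) θ) +
          (klFlowPiece L M β U μ n).eval (klFermiPoint μ (klFlowFrameU L M β U μ n) θ))) ∧
    ∀ k ≤ 4, ∀ θ : ℝ, |iteratedDeriv k (fun θ : ℝ =>
      ((symInterp L (klLocSelfEnergyRe L M β U μ (klFlowFrameU L M β U μ (n + 1)) (n + 1))).eval
            (klFermiPoint μ (klFlowFrameU L M β U μ (n + 1)) θ) +
          (klFlowPiece L M β U μ n).eval (klFermiPoint μ (klFlowFrameU L M β U μ (n + 1)) θ)) -
        ((symInterp L (klLocSelfEnergyRe L M β U μ (klFlowFrameU L M β U μ (n + 1)) (n + 1))).eval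
            (klFermiPoint μ (klFlowFrameU L M β U μ n) θ) +
          (klFlowPiece L M β U μ n).eval (klFermiPoint μ (klFlowFrameU L M β U μ n) θ))) θ| ≤
      curveJetBar (fun k : ℕ => if k = 0 then 0 else
        (fun k : ℕ =>
          if k = 0 then 16 * ((12.2 * R.Gfr 0 * m 1))
          else if k = 1 then 4 * ((1420 * 2 * (R.Gfr 1 + R.Gfr 2 + R.Gfr 3 + R.Gfr 4) * 2 * m 1) + (36400 * R.Gfr 0 * m 1) + (2820 * R.Gfr 0 * m 2))
          else if k = 2 then ((12900000 * 2 ^ 2 * (R.Gfr 1 + R.Gfr 2 + R.Gfr 3 + R.Gfr 4) * 2 ^ 2 * m 1) + (657000 * 2 * (R.Gfr 1 + R.Gfr 2 + R.Gfr 3 + R.Gfr 4) * 2 * m 2) + (338000000 * 2 * R.Gfr 0 * 2 * m 1) + (25400000 * R.Gfr 0 * m 2) + (652000 * R.Gfr 0 * m 3))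
          else if k = 3 then ((199000000000 * 2 ^ 3 * (R.Gfr 1 + R.Gfr 2 + R.Gfr 3 + R.Gfr 4) * 2 ^ 3 * m 1) + (12000000000 * 2 ^ 2 * (R.Gfr 1 + R.Gfr 2 + R.Gfr 3 + R.Gfr 4) * 2 ^ 2 * m 2) + (228000000 * 2 * (R.Gfr 1 + R.Gfr 2 + R.Gfr 3 + R.Gfr 4) * 2 * m 3) + (5230000000000 * 2 ^ 2 * R.Gfr 0 * 2 ^ 2 * m 1) + (392000000000 * 2 * R.Gfr 0 * 2 * m 2) + (11800000000 * R.Gfr 0 * m 3) + (151000000 * R.Gfr 0 * m 4)) / 4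
          else if k = 4 then ((4300000000000000 * 2 ^ 4 * (R.Gfr 1 + R.Gfr 2 + R.Gfr 3 + R.Gfr 4) * 2 ^ 4 * m 1) + (276000000000000 * 2 ^ 3 * (R.Gfr 1 + R.Gfr 2 + R.Gfr 3 + R.Gfr 4) * 2 ^ 3 * m 2) + (6890000000000 * 2 ^ 2 * (R.Gfr 1 + R.Gfr 2 + R.Gfr 3 + R.Gfr 4) * 2 ^ 2 * m 3) + (70100000000 * 2 * (R.Gfr 1 + R.Gfr 2 + R.Gfr 3 + R.Gfr 4) * 2 * m 4) + (114000000000000000 * 2 ^ 2 * R.Gfr 0 * 2 ^ 2 * m 1) + (8490000000000000 * 2 ^ 2 * R.Gfr 0 * 2 ^ 2 * m 2) + (272000000000000 * 2 * R.Gfr 0 * 2 * m 3) + (4530000000000 * R.Gfr 0 * m 4) + (34800000000 * R.Gfr 0 * m 5) + (69200000000 * (16 / 15) * R.Gfr 4 * m 1)) / 16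
          else 0) k * U₀)
        (fun k : ℕ => if k = 0 then
        (fun k : ℕ =>
          if k = 0 then 16 * ((12.2 * R.Gfr 0 * m 1))
          else if k = 1 then 4 * ((1420 * 2 * (R.Gfr 1 + R.Gfr 2 + R.Gfr 3 + R.Gfr 4) * 2 * m 1) + (36400 * R.Gfr 0 * m 1) + (2820 * R.Gfr 0 * m 2))
          else if k = 2 then ((12900000 * 2 ^ 2 * (R.Gfr 1 + R.Gfr 2 + R.Gfr 3 + R.Gfr 4) * 2 ^ 2 * m 1) + (657000 * 2 * (R.Gfr 1 + R.Gfr 2 + R.Gfr 3 + R.Gfr 4) * 2 * m 2) + (338000000 * 2 * R.Gfr 0 * 2 * m 1) + (25400000 * R.Gfr 0 * m 2) + (652000 * R.Gfr 0 * m 3))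
          else if k = 3 then ((199000000000 * 2 ^ 3 * (R.Gfr 1 + R.Gfr 2 + R.Gfr 3 + R.Gfr 4) * 2 ^ 3 * m 1) + (12000000000 * 2 ^ 2 * (R.Gfr 1 + R.Gfr 2 + R.Gfr 3 + R.Gfr 4) * 2 ^ 2 * m 2) + (228000000 * 2 * (R.Gfr 1 + R.Gfr 2 + R.Gfr 3 + R.Gfr 4) * 2 * m 3) + (5230000000000 * 2 ^ 2 * R.Gfr 0 * 2 ^ 2 * m 1) + (392000000000 * 2 * R.Gfr 0 * 2 * m 2) + (11800000000 * R.Gfr 0 * m 3) + (151000000 * R.Gfr 0 * m 4)) / 4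
          else if k = 4 then ((4300000000000000 * 2 ^ 4 * (R.Gfr 1 + R.Gfr 2 + R.Gfr 3 + R.Gfr 4) * 2 ^ 4 * m 1) + (276000000000000 * 2 ^ 3 * (R.Gfr 1 + R.Gfr 2 + R.Gfr 3 + R.Gfr 4) * 2 ^ 3 * m 2) + (6890000000000 * 2 ^ 2 * (R.Gfr 1 + R.Gfr 2 + R.Gfr 3 + R.Gfr 4) * 2 ^ 2 * m 3) + (70100000000 * 2 * (R.Gfr 1 + R.Gfr 2 + R.Gfr 3 + R.Gfr 4) * 2 * m 4) + (114000000000000000 * 2 ^ 2 * R.Gfr 0 * 2 ^ 2 * m 1) + (8490000000000000 * 2 ^ 2 * R.Gfr 0 * 2 ^ 2 * m 2) + (272000000000000 * 2 * R.Gfr 0 * 2 * m 3) + (4530000000000 * R.Gfr 0 * m 4) + (34800000000 * R.Gfr 0 * m 5) + (69200000000 * (16 / 15) * R.Gfr 4 * m 1)) / 16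
          else 0) 0 * U₀ else 0)
        U k (n + 1) := by
  obtain ⟨-, hdeg1⟩ := degree_klFlowFrameU_le_half (L := L) (M := M) (β := β) (U := U) (μ := μ) (n := n) hLdeg
  have hβ0 : 0 < β := KLRegimeSplit.pos_of_klBetaMin_le hβmin
  have hU1 : U ≤ 1 := hUle.trans (klCurveU0_le_one R)
  have hx : (1 : ℝ) ≤ (4 : ℝ) ^ n := one_le_pow₀ (by norm_num)
  -- (a) frame jets of `K_n`, (b) separated jets at `(K_{n+1}, n+1)` from the export
  have ha := flowFrame_jets_lawA (L := L) (M := M) hR hGS hQS hμ hX hP hT (n := n) (by omega)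
  have hb := sep_jets_of_twoLegDualSpaceMomentsUpToAt hβ0 hZ'
  -- the symbol equals `evalM K_n + evalM SI(S̃_{n+1})`
  have hFsplit : (fun q : Momentum => (symInterp L (klLocSelfEnergyRe L M β U μ (klFlowFrameU L M β U μ (n + 1)) (n + 1))).eval (WithLp.ofLp q) + (klFlowPiece L M β U μ n).eval (WithLp.ofLp q)) =
      fun q : Momentum => evalM (klFlowFrameU L M β U μ n) q + evalM (symInterp L (fun k => klLocSelfEnergyRe L M β U μ (klFlowFrameU L M β U μ (n + 1)) (n + 1) k - (klFlowFrameU L M β U μ (n + 1)).eval (latticeMomentum L k))) q := by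
    have hs := cumulativeSymbol_eq_frame_add_sep (L := L) (M := M) β U μ hdeg1 (n + 1)
    funext q
    have hq : (symInterp L (klLocSelfEnergyRe L M β U μ (klFlowFrameU L M β U μ (n + 1)) (n + 1))).eval (WithLp.ofLp q) =
        evalM (klFlowFrameU L M β U μ (n + 1)) q + evalM (symInterp L (fun k => klLocSelfEnergyRe L M β U μ (klFlowFrameU L M β U μ (n + 1)) (n + 1) k - (klFlowFrameU L M β U μ (n + 1)).eval (latticeMomentum L k))) q := congrFun hs q
    have hKq : evalM (klFlowFrameU L M β U μ (n + 1)) q + (klFlowPiece L M β U μ n).eval (WithLp.ofLp q) = evalM (klFlowFrameU L M β U μ n) q := by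
      rw [klFlowFrameU_succ]; simp only [evalM, eval_fsub]; ring
    show (symInterp L (klLocSelfEnergyRe L M β U μ (klFlowFrameU L M β U μ (n + 1)) (n + 1))).eval (WithLp.ofLp q) + (klFlowPiece L M β U μ n).eval (WithLp.ofLp q) =
      evalM (klFlowFrameU L M β U μ n) q + evalM (symInterp L (fun k => klLocSelfEnergyRe L M β U μ (klFlowFrameU L M β U μ (n + 1)) (n + 1) k - (klFlowFrameU L M β U μ (n + 1)).eval (latticeMomentum L k))) q
    rw [hq]
    linarith
  have hj : ∀ j, 1 ≤ j → j ≤ 5 → ∀ q : Momentum, ‖iteratedFDeriv ℝ j (fun q : Momentum => (symInterp L (klLocSelfEnergyRe L M β U μ (klFlowFrameU L M β U μ (n + 1)) (n + 1))).eval (WithLp.ofLp q) + (klFlowPiece L M β U μ n).eval (WithLp.ofLp q)) q‖ ≤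
      (if j = 1 then 4 / 3 * R.Gfr 1 * U ^ 2 * ((4 : ℝ) ^ n) ^ 0 else if j = 2 then R.Gfr 2 * U ^ 2 * ((4 : ℝ) ^ n) ^ 1 else if j = 3 then R.Gfr 3 / 3 * U ^ 2 * ((4 : ℝ) ^ n) ^ 2 else if j = 4 then R.Gfr 4 / 15 * U ^ 2 * ((4 : ℝ) ^ n) ^ 3 else 2 ^ 5 * (Real.pi ^ 8 / 4 * 2 ^ 4 * (2 : ℝ) ^ 32) * (curveExtC X G.S 1 + curveExtC X Q.S' 1 * |U|) / 63 * U ^ 2 * ((4 : ℝ) ^ n) ^ 4) + 2 * klZspLaw z U (n + 1) j := by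
    rw [hFsplit]
    exact jets_evalM_add_evalM (a := fun j => (if j = 1 then 4 / 3 * R.Gfr 1 * U ^ 2 * ((4 : ℝ) ^ n) ^ 0 else if j = 2 then R.Gfr 2 * U ^ 2 * ((4 : ℝ) ^ n) ^ 1 else if j = 3 then R.Gfr 3 / 3 * U ^ 2 * ((4 : ℝ) ^ n) ^ 2 else if j = 4 then R.Gfr 4 / 15 * U ^ 2 * ((4 : ℝ) ^ n) ^ 3 else 2 ^ 5 * (Real.pi ^ 8 / 4 * 2 ^ 4 * (2 : ℝ) ^ 32) * (curveExtC X G.S 1 + curveExtC X Q.S' 1 * |U|) / 63 * U ^ 2 * ((4 : ℝ) ^ n) ^ 4)) (b := fun j => 2 * klZspLaw z U (n + 1) j) ha hb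
  obtain ⟨hM₁, hM₂, hM₃, hM₄, hM₅⟩ := nested_five_of_jets hj
  have hF5 : ContDiff ℝ 5 (fun q : Momentum => (symInterp L (klLocSelfEnergyRe L M β U μ (klFlowFrameU L M β U μ (n + 1)) (n + 1))).eval (WithLp.ofLp q) + (klFlowPiece L M β U μ n).eval (WithLp.ofLp q)) :=
    (cumulativeSymbol_contDiff (L := L) (M := M) β U μ (klFlowFrameU L M β U μ (n + 1)) (n + 1) (k := 5)).add (contDiff_evalM (klFlowPiece L M β U μ n))
  -- the door at `(K₀, p, n) := (K_n, p_n, n)` with the canonical graded parameters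
  obtain ⟨hl1', hA3, hA4, hh0, hhη⟩ := flow_graded_params hR U n
  have hη_nn : 0 ≤ (R.Gfr 1 + R.Gfr 2 + R.Gfr 3 + R.Gfr 4) * U ^ 2 * ((4 : ℝ) ^ (2 * n))⁻¹ := by
    have := hR 1; have := hR 2; have := hR 3; have := hR 4; positivity
  have hη₀_nn : 0 ≤ R.Gfr 0 * |U| * ((4 : ℝ) ^ (2 * n))⁻¹ := by have := hR 0; positivity
  have hK' : FrameOK R U n μ (fsub (klFlowFrameU L M β U μ n) (klFlowPiece L M β U μ n)) := by
    rw [← klFlowFrameU_succ]; exact hK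
  obtain ⟨hdiff, hrows⟩ := transport_jets_of_frameOK_fun hR hc hcle hU hUle hβmin hβc hμ hn hK₀ hK' (hP n hnn') hη_nn hη₀_nn hl1' hA3 hA4 hh0 hhη
    hF5 hM₁ hM₂ hM₃ hM₄ hM₅
  have hfun : (fun θ : ℝ =>
      ((symInterp L (klLocSelfEnergyRe L M β U μ (klFlowFrameU L M β U μ (n + 1)) (n + 1))).eval
            (klFermiPoint μ (klFlowFrameU L M β U μ (n + 1)) θ) +
          (klFlowPiece L M β U μ n).eval (klFermiPoint μ (klFlowFrameU L M β U μ (n + 1)) θ)) -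
        ((symInterp L (klLocSelfEnergyRe L M β U μ (klFlowFrameU L M β U μ (n + 1)) (n + 1))).eval
            (klFermiPoint μ (klFlowFrameU L M β U μ n) θ) +
          (klFlowPiece L M β U μ n).eval (klFermiPoint μ (klFlowFrameU L M β U μ n) θ))) =
      fun θ : ℝ =>
        (fun q : Momentum => (symInterp L (klLocSelfEnergyRe L M β U μ (klFlowFrameU L M β U μ (n + 1)) (n + 1))).eval (WithLp.ofLp q) + (klFlowPiece L M β U μ n).eval (WithLp.ofLp q))
            (WithLp.toLp 2 (klFermiPoint μ (fsub (klFlowFrameU L M β U μ n) (klFlowPiece L M β U μ n)) θ)) -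
          (fun q : Momentum => (symInterp L (klLocSelfEnergyRe L M β U μ (klFlowFrameU L M β U μ (n + 1)) (n + 1))).eval (WithLp.ofLp q) + (klFlowPiece L M β U μ n).eval (WithLp.ofLp q))
            (WithLp.toLp 2 (klFermiPoint μ (klFlowFrameU L M β U μ n) θ)) := by
    funext θ
    simp only [klFlowFrameU_succ]
  rw [hfun]
  refine ⟨hdiff, fun k hk θ => ?_⟩
  obtain ⟨r0, r1, r2, r3, r4⟩ := hrows θ
  -- nonnegativity of the five sizes and the moment law at base `4ⁿ`
  have hX0 : 0 ≤ X := (norm_nonneg _).trans (hX 0 (by norm_num) 0)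
  have hW : 0 ≤ (curveExtC X G.S 1 + curveExtC X Q.S' 1 * |U|) := by
    have hc1 := curveExtC_nonneg hX0 hGS 1
    have hc2 := curveExtC_nonneg hX0 hQS 1
    positivity
  have hw : ∀ p : ℕ, 0 ≤ U ^ 2 * ((4 : ℝ) ^ n) ^ p := fun p => by positivity
  have hzl : ∀ j, 0 ≤ 2 * klZspLaw z U (n + 1) j := fun j => by
    have := klZspLaw_nonneg hz U (n + 1) j; linarith
  have hG1 := hR 1; have hG2 := hR 2; have hG3 := hR 3; have hG4 := hR 4
  have hM1' : 0 ≤ (if (1 : ℕ) = 1 then 4 / 3 * R.Gfr 1 * U ^ 2 * ((4 : ℝ) ^ n) ^ 0 else if (1 : ℕ) = 2 then R.Gfr 2 * U ^ 2 * ((4 : ℝ) ^ n) ^ 1 else if (1 : ℕ) = 3 then R.Gfr 3 / 3 * U ^ 2 * ((4 : ℝ) ^ n) ^ 2 else if (1 : ℕ) = 4 then R.Gfr 4 / 15 * U ^ 2 * ((4 : ℝ) ^ n) ^ 3 else 2 ^ 5 * (Real.pi ^ 8 / 4 * 2 ^ 4 * (2 : ℝ) ^ 32) * (curveExtC X G.S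 1 + curveExtC X Q.S' 1 * |U|) / 63 * U ^ 2 * ((4 : ℝ) ^ n) ^ 4) + 2 * klZspLaw z U (n + 1) 1 := by
    rw [if_pos rfl]; exact add_nonneg (by positivity) (hzl 1)
  have hM2' : 0 ≤ (if (2 : ℕ) = 1 then 4 / 3 * R.Gfr 1 * U ^ 2 * ((4 : ℝ) ^ n) ^ 0 else if (2 : ℕ) = 2 then R.Gfr 2 * U ^ 2 * ((4 : ℝ) ^ n) ^ 1 else if (2 : ℕ) = 3 then R.Gfr 3 / 3 * U ^ 2 * ((4 : ℝ) ^ n) ^ 2 else if (2 : ℕ) = 4 then R.Gfr 4 / 15 * U ^ 2 * ((4 : ℝ) ^ n) ^ 3 else 2 ^ 5 * (Real.pi ^ 8 / 4 * 2 ^ 4 * (2 : ℝ) ^ 32) * (curveExtC X G.S 1 + curveExtC X Q.S' 1 * |U|) / 63 * U ^ 2 * ((4 : ℝ) ^ n) ^ 4) + 2 * klZspLaw z U (n + 1) 2 := by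
    rw [if_neg (by norm_num), if_pos rfl]; exact add_nonneg (by positivity) (hzl 2)
  have hM3' : 0 ≤ (if (3 : ℕ) = 1 then 4 / 3 * R.Gfr 1 * U ^ 2 * ((4 : ℝ) ^ n) ^ 0 else if (3 : ℕ) = 2 then R.Gfr 2 * U ^ 2 * ((4 : ℝ) ^ n) ^ 1 else if (3 : ℕ) = 3 then R.Gfr 3 / 3 * U ^ 2 * ((4 : ℝ) ^ n) ^ 2 else if (3 : ℕ) = 4 then R.Gfr 4 / 15 * U ^ 2 * ((4 : ℝ) ^ n) ^ 3 else 2 ^ 5 * (Real.pi ^ 8 / 4 * 2 ^ 4 * (2 : ℝ) ^ 32) * (curveExtC X G.S 1 + curveExtC X Q.S' 1 * |U|) / 63 * U ^ 2 * ((4 : ℝ) ^ n) ^ 4) + 2 * klZspLaw z U (n + 1) 3 := by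
    rw [if_neg (by norm_num), if_neg (by norm_num), if_pos rfl]; exact add_nonneg (by positivity) (hzl 3)
  have hM4' : 0 ≤ (if (4 : ℕ) = 1 then 4 / 3 * R.Gfr 1 * U ^ 2 * ((4 : ℝ) ^ n) ^ 0 else if (4 : ℕ) = 2 then R.Gfr 2 * U ^ 2 * ((4 : ℝ) ^ n) ^ 1 else if (4 : ℕ) = 3 then R.Gfr 3 / 3 * U ^ 2 * ((4 : ℝ) ^ n) ^ 2 else if (4 : ℕ) = 4 then R.Gfr 4 / 15 * U ^ 2 * ((4 : ℝ) ^ n) ^ 3 else 2 ^ 5 * (Real.pi ^ 8 / 4 * 2 ^ 4 * (2 : ℝ) ^ 32) * (curveExtC X G.S 1 + curveExtC X Q.S' 1 * |U|) / 63 * U ^ 2 * ((4 : ℝ) ^ n) ^ 4) + 2 * klZspLaw z U (n + 1) 4 := by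
    rw [if_neg (by norm_num), if_neg (by norm_num), if_neg (by norm_num), if_pos rfl]; exact add_nonneg (by positivity) (hzl 4)
  have hM5' : 0 ≤ (if (5 : ℕ) = 1 then 4 / 3 * R.Gfr 1 * U ^ 2 * ((4 : ℝ) ^ n) ^ 0 else if (5 : ℕ) = 2 then R.Gfr 2 * U ^ 2 * ((4 : ℝ) ^ n) ^ 1 else if (5 : ℕ) = 3 then R.Gfr 3 / 3 * U ^ 2 * ((4 : ℝ) ^ n) ^ 2 else if (5 : ℕ) = 4 then R.Gfr 4 / 15 * U ^ 2 * ((4 : ℝ) ^ n) ^ 3 else 2 ^ 5 * (Real.pi ^ 8 / 4 * 2 ^ 4 * (2 : ℝ) ^ 32) * (curveExtC X G.S 1 + curveExtC X Q.S' 1 * |U|) / 63 * U ^ 2 * ((4 : ℝ) ^ n) ^ 4) + 2 * klZspLaw z U (n + 1) 5 := by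
    rw [if_neg (by norm_num), if_neg (by norm_num), if_neg (by norm_num), if_neg (by norm_num)]
    exact add_nonneg (mul_nonneg (mul_nonneg (div_nonneg (mul_nonneg (by positivity) hW) (by norm_num)) (sq_nonneg U)) (by positivity)) (hzl 5)
  have hlaw1 : (if (1 : ℕ) = 1 then 4 / 3 * R.Gfr 1 * U ^ 2 * ((4 : ℝ) ^ n) ^ 0 else if (1 : ℕ) = 2 then R.Gfr 2 * U ^ 2 * ((4 : ℝ) ^ n) ^ 1 else if (1 : ℕ) = 3 then R.Gfr 3 / 3 * U ^ 2 * ((4 : ℝ) ^ n) ^ 2 else if (1 : ℕ) = 4 then R.Gfr 4 / 15 * U ^ 2 * ((4 : ℝ) ^ n) ^ 3 else 2 ^ 5 * (Real.pi ^ 8 / 4 * 2 ^ 4 * (2 : ℝ) ^ 32) * (curveExtC X G.S 1 + curveExtC X Q.S' 1 * |U|) / 63 * U ^ 2 * ((4 : ℝ) ^ n) ^ 4) + 2 * klZspLaw z U (n + 1) 1 ≤ m 1 * U ^ 2 * ((4 : ℝ) ^ n) ^ 0 := by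
    rw [if_pos rfl, two_mul_klZspLaw, show (1 : ℕ) - 1 = 0 from rfl, pow_succ (4 : ℝ) n]
    calc _ = (4 / 3 * R.Gfr 1 + 2 * z 1) * (U ^ 2 * ((4 : ℝ) ^ n) ^ 0) := by ring
      _ ≤ m 1 * (U ^ 2 * ((4 : ℝ) ^ n) ^ 0) := mul_le_mul_of_nonneg_right hl1 (hw 0)
      _ = m 1 * U ^ 2 * ((4 : ℝ) ^ n) ^ 0 := by ring
  have hlaw2 : (if (2 : ℕ) = 1 then 4 / 3 * R.Gfr 1 * U ^ 2 * ((4 : ℝ) ^ n) ^ 0 else if (2 : ℕ) = 2 then R.Gfr 2 * U ^ 2 * ((4 : ℝ) ^ n) ^ 1 else if (2 : ℕ) = 3 then R.Gfr 3 / 3 * U ^ 2 * ((4 : ℝ) ^ n) ^ 2 else if (2 : ℕ) = 4 then R.Gfr 4 / 15 * U ^ 2 * ((4 : ℝ) ^ n) ^ 3 else 2 ^ 5 * (Real.pi ^ 8 / 4 * 2 ^ 4 * (2 : ℝ) ^ 32) * (curveExtC X G.S 1 + curveExtC X Q.S' 1 * |U|) / 63 * U ^ 2 * ((4 : ℝ)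 ^ n) ^ 4) + 2 * klZspLaw z U (n + 1) 2 ≤ m 2 * U ^ 2 * ((4 : ℝ) ^ n) ^ 1 := by
    rw [if_neg (by norm_num), if_pos rfl, two_mul_klZspLaw, show (2 : ℕ) - 1 = 1 from rfl, pow_succ (4 : ℝ) n]
    calc _ = (R.Gfr 2 + 8 * z 2) * (U ^ 2 * ((4 : ℝ) ^ n) ^ 1) := by ring
      _ ≤ m 2 * (U ^ 2 * ((4 : ℝ) ^ n) ^ 1) := mul_le_mul_of_nonneg_right hl2 (hw 1)
      _ = m 2 * U ^ 2 * ((4 : ℝ) ^ n) ^ 1 := by ring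
  have hlaw3 : (if (3 : ℕ) = 1 then 4 / 3 * R.Gfr 1 * U ^ 2 * ((4 : ℝ) ^ n) ^ 0 else if (3 : ℕ) = 2 then R.Gfr 2 * U ^ 2 * ((4 : ℝ) ^ n) ^ 1 else if (3 : ℕ) = 3 then R.Gfr 3 / 3 * U ^ 2 * ((4 : ℝ) ^ n) ^ 2 else if (3 : ℕ) = 4 then R.Gfr 4 / 15 * U ^ 2 * ((4 : ℝ) ^ n) ^ 3 else 2 ^ 5 * (Real.pi ^ 8 / 4 * 2 ^ 4 * (2 : ℝ) ^ 32) * (curveExtC X G.S 1 + curveExtC X Q.S' 1 * |U|) / 63 * U ^ 2 * ((4 : ℝ) ^ n) ^ 4) + 2 * klZspLaw z U (n + 1) 3 ≤ m 3 * U ^ 2 * ((4 : ℝ) ^ n) ^ 2 := by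
    rw [if_neg (by norm_num), if_neg (by norm_num), if_pos rfl, two_mul_klZspLaw, show (3 : ℕ) - 1 = 2 from rfl, pow_succ (4 : ℝ) n]
    calc _ = (R.Gfr 3 / 3 + 32 * z 3) * (U ^ 2 * ((4 : ℝ) ^ n) ^ 2) := by ring
      _ ≤ m 3 * (U ^ 2 * ((4 : ℝ) ^ n) ^ 2) := mul_le_mul_of_nonneg_right hl3 (hw 2)
      _ = m 3 * U ^ 2 * ((4 : ℝ) ^ n) ^ 2 := by ring
  have hlaw4 : (if (4 : ℕ) = 1 then 4 / 3 * R.Gfr 1 * U ^ 2 * ((4 : ℝ) ^ n) ^ 0 else if (4 : ℕ) = 2 then R.Gfr 2 * U ^ 2 * ((4 : ℝ) ^ n) ^ 1 else if (4 : ℕ) = 3 then R.Gfr 3 / 3 * U ^ 2 * ((4 : ℝ) ^ n) ^ 2 else if (4 : ℕ) = 4 then R.Gfr 4 / 15 * U ^ 2 * ((4 : ℝ) ^ n) ^ 3 else 2 ^ 5 * (Real.pi ^ 8 / 4 * 2 ^ 4 * (2 : ℝ) ^ 32) * (curveExtC X G.S 1 + curveExtC X Q.S' 1 * |U|) / 63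 * U ^ 2 * ((4 : ℝ) ^ n) ^ 4) + 2 * klZspLaw z U (n + 1) 4 ≤ m 4 * U ^ 2 * ((4 : ℝ) ^ n) ^ 3 := by
    rw [if_neg (by norm_num), if_neg (by norm_num), if_neg (by norm_num), if_pos rfl, two_mul_klZspLaw, show (4 : ℕ) - 1 = 3 from rfl, pow_succ (4 : ℝ) n]
    calc _ = (R.Gfr 4 / 15 + 128 * z 4) * (U ^ 2 * ((4 : ℝ) ^ n) ^ 3) := by ring
      _ ≤ m 4 * (U ^ 2 * ((4 : ℝ) ^ n) ^ 3) := mul_le_mul_of_nonneg_right hl4 (hw 3)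
      _ = m 4 * U ^ 2 * ((4 : ℝ) ^ n) ^ 3 := by ring
  have hlaw5 : (if (5 : ℕ) = 1 then 4 / 3 * R.Gfr 1 * U ^ 2 * ((4 : ℝ) ^ n) ^ 0 else if (5 : ℕ) = 2 then R.Gfr 2 * U ^ 2 * ((4 : ℝ) ^ n) ^ 1 else if (5 : ℕ) = 3 then R.Gfr 3 / 3 * U ^ 2 * ((4 : ℝ) ^ n) ^ 2 else if (5 : ℕ) = 4 then R.Gfr 4 / 15 * U ^ 2 * ((4 : ℝ) ^ n) ^ 3 else 2 ^ 5 * (Real.pi ^ 8 / 4 * 2 ^ 4 * (2 : ℝ) ^ 32) * (curveExtC X G.S 1 + curveExtC X Q.S' 1 * |U|) / 63 * U ^ 2 * ((4 : ℝ) ^ n) ^ 4) + 2 * klZspLaw z U (n + 1) 5 ≤ m 5 * U ^ 2 * ((4 : ℝ) ^ n) ^ 4 := by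
    rw [if_neg (by norm_num), if_neg (by norm_num), if_neg (by norm_num), if_neg (by norm_num), two_mul_klZspLaw, show (5 : ℕ) - 1 = 4 from rfl, pow_succ (4 : ℝ) n]
    calc _ = (2 ^ 5 * (Real.pi ^ 8 / 4 * 2 ^ 4 * (2 : ℝ) ^ 32) * (curveExtC X G.S 1 + curveExtC X Q.S' 1 * |U|) / 63 + 512 * z 5) * (U ^ 2 * ((4 : ℝ) ^ n) ^ 4) := by ring
      _ ≤ m 5 * (U ^ 2 * ((4 : ℝ) ^ n) ^ 4) := mul_le_mul_of_nonneg_right hl5 (hw 4)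
      _ = m 5 * U ^ 2 * ((4 : ℝ) ^ n) ^ 4 := by ring
  have hUabs : |U| ≤ U₀ := by rwa [abs_of_pos hU]
  by_cases hk0 : k = 0
  · subst hk0
    exact transport_value_u0 (hR 0) hU hU0 n (hm 1) hlaw1 r0 (if_pos rfl) (by norm_num)
  · have hrow := transport_rows_fit_l2 hR hU hU1 hG34U n hM1' hM2' hM3' hM4' hM5' hm hlaw1 hlaw2 hlaw3 hlaw4 hlaw5
      (D := (fun k => |iteratedDeriv k (fun θ : ℝ =>
      ((symInterp L (klLocSelfEnergyRe L M β U μ (klFlowFrameU L M β U μ (n + 1)) (n + 1))).eval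
            (klFermiPoint μ (klFlowFrameU L M β U μ (n + 1)) θ) +
          (klFlowPiece L M β U μ n).eval (klFermiPoint μ (klFlowFrameU L M β U μ (n + 1)) θ)) -
        ((symInterp L (klLocSelfEnergyRe L M β U μ (klFlowFrameU L M β U μ (n + 1)) (n + 1))).eval
            (klFermiPoint μ (klFlowFrameU L M β U μ n) θ) +
          (klFlowPiece L M β U μ n).eval (klFermiPoint μ (klFlowFrameU L M β U μ n) θ))) θ|)) r0 r1 r2 r3 r4 k hk
    exact hrow.trans (curveJetBar_zero_le_of_tables hUabs (transportTableL2_nonneg hR hm k) (by simp [hk0]) (by simp [hk0]) (n + 1))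


end AtSucc

end General

end Summit.HubbardSuperconductivity.HubbardSuperconductivity.Theorems.EngineV8

end
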